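import Literature.AlgebraicGeometry.Modules.PushforwardBaseChangeOpenImmersion
import HarnessLib

/-!
# The base-change morphism of a PASTED square: `β_{H·H₁} = v^* β_{H₁} ≫ β_H`

[StacksProject, Tag 02N6] (the base change map is compatible with horizontal composition of squares) /
[Hartshorne1977] III Prop. 9.3 (Remark 9.3.1): for two commutative squares of schemes pasted horizontally
```
XT —pr→ X₁ —pr₁→ X₀
 |pT      |p₁        |p₀          `w₁ : pr₁ ≫ p₀ = p₁ ≫ j`,  `w : pr ≫ p₁ = pT ≫ v`
 T ——v——→ S₁ ——j——→ S₀
```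
and an `𝒪_{X₀}`-module `G`, the base-change morphism `β_{w'} : (v ≫ j)^*(p₀)_* G ⟶ (pT)_*(pr ≫ pr₁)^* G` of the OUTER
square (★ `Modules/PushforwardBaseChangeHom.pushforwardBaseChangeHom`) is the composite of `v^*(β_{w₁})` and `β_w`, up to
the pseudofunctoriality isomorphisms `(v ≫ j)^* ≅ v^* j^*`, `pr^* pr₁^* ≅ (pr ≫ pr₁)^*` of Mathlib's
`Scheme.Modules.pullbackComp`:

* §1 **`pullback_hom_ext_unitSection`** — morphisms out of an inverse image `f^*M` are determined by their values on
  the pulled-back sections `η_f(m)` (the transposes across `f^* ⊣ f_*` have components `m ↦ φ(η_f(m))`);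
* §2 **`pushforwardBaseChangeHom_paste`** — THE PASTING LAW, proved on pulled-back sections: both sides send
  `η_{v ≫ j}(s)` to `η_{pr ≫ pr₁}(s)` (★ `pushforwardBaseChangeHom_app_unitSection`, ★ `pullbackComp_{hom,inv}_app_unitSection`);
  **`isIso_pullback_map_comp_pushforwardBaseChangeHom_iff_of_paste`** / **`…_of_isPullback_paste_horiz`** — for any
  `u : E ⟶ (p₀)_* G`, «`v^*(j^*u ≫ β_{w₁}) ≫ β_w` is an isomorphism iff `(v ≫ j)^* u ≫ β_{w'}` is»: the clause
  «the sections `u` restricted to the fibre product frame the direct image» ([MumfordFogartyKirwan1994] Prop. 7.3 step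
  (VI), ★ `Modules/CompleteLinearSystemLocus`) read on the square over `S₁` along `v` agrees with the same clause read on
  the square over `S₀` along `v ≫ j`;
* §3 **`pushforwardBaseChangeHom_congr_fst`** / **`isIso_pullback_map_comp_pushforwardBaseChangeHom_iff_of_eq_fst`** —
  insensitivity to replacing the top arrow `pr` by an equal one (two presentations of the same cartesian square, e.g.
  `K` and `(K.of_right …).paste_horiz H₁`), and **`nonempty_iso_iff_of_iso`** / **`nonempty_pullback_pullback_iso_iff`** — a
  module clause `Nonempty (pr^*(pr₁^* L) ≅ N)` agrees with `Nonempty ((pr ≫ pr₁)^* L ≅ N)`.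

Theorems only (no definition, no instance, no notation, no named fact, no `sorry`).  Cell hodgecm-mathlib (D-0151), F-DAG
leaf F-6: the (T2) «module transport» seam of the capstone `AbelianSchemes/MFKSubfunctorOfHilb` (census
`B-provers/B-p18/g19/CENSUS-F6-Capstone-MFKSubfunctorOfHilb.B-p18g19.md` F5, (T2-mod-a)/(T2-mod-b); B-p01 (g14)).
Count-neutral Mathlib-side capital: HC_CM is proved only modulo the 7 printed citations until rung 0 closes — nothing here
is about HC.

## References
* [StacksProject] The Stacks Project, Tag 02N6 (base change map and its compatibilities), Tag 0096 (`f^* ⊣ f_*`), Tag 0097 (composition of pullbacks).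
* [Hartshorne1977] R. Hartshorne, *Algebraic Geometry* (1977), II §5 p. 110 (`f^* ⊣ f_*`), III Prop. 9.3 (Remark 9.3.1).
* [MumfordFogartyKirwan1994] D. Mumford, J. Fogarty, F. Kirwan, *Geometric Invariant Theory*, 3rd ed. (1994), Ch. 7 §2
  Prop. 7.3, step (VI) of the proof (p. 134).
-/

noncomputable section

-- `TopCat.Presheaf`/`Scheme.Modules` are not reducible (as in Mathlib's `AlgebraicGeometry/Modules/Sheaf.lean`).
set_option backward.isDefEq.respectTransparency false

open CategoryTheory CategoryTheory.Limits AlgebraicGeometry TopologicalSpace Opposite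

universe u

namespace Literature.AlgebraicGeometry.Modules

/-! ### §1 Morphisms out of an inverse image are determined by their values on pulled-back sections -/

section Ext

variable {X Y : Scheme.{u}} (f : X ⟶ Y) (M : Y.Modules) {N : X.Modules}

/-- **Morphisms out of `f^*M` are determined by their values on the pulled-back sections `η_f(m)`**
(`m ∈ Γ(M, V)`, `V ⊆ Y` open): both transposes `M ⟶ f_* N` across `f^* ⊣ f_*` have the components
`m ↦ φ(η_f(m))`. [cite: Hartshorne1977, II §5 p. 110] [cite: StacksProject, Tag 0096] -/
theorem pullback_hom_ext_unitSection {φ φ' : (Scheme.Modules.pullback f).obj M ⟶ N}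
    (h : ∀ (V : Y.Opens) (m : Γ(M, V)),
      φ.app (f ⁻¹ᵁ V) (unitSection f M V m) = φ'.app (f ⁻¹ᵁ V) (unitSection f M V m)) :
    φ = φ' := by
  apply ((Scheme.Modules.pullbackPushforwardAdjunction f).homEquiv _ _).injective
  apply Scheme.Modules.hom_ext
  intro V
  ext m
  rw [Adjunction.homEquiv_unit, Adjunction.homEquiv_unit, Scheme.Modules.Hom.comp_app,
    Scheme.Modules.Hom.comp_app, CategoryTheory.comp_apply, CategoryTheory.comp_apply,
    Scheme.Modules.pushforward_map_app, Scheme.Modules.pushforward_map_app]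
  exact h V m

end Ext

/-! ### §2 The base-change morphism of a horizontally pasted square -/

section Paste

variable {X₀ X₁ XT S₀ S₁ T : Scheme.{u}} {p₀ : X₀ ⟶ S₀} {p₁ : X₁ ⟶ S₁} {pT : XT ⟶ T}
  {pr₁ : X₁ ⟶ X₀} {j : S₁ ⟶ S₀} {pr : XT ⟶ X₁} {v : T ⟶ S₁}
  (w₁ : pr₁ ≫ p₀ = p₁ ≫ j) (w : pr ≫ p₁ = pT ≫ v) (w' : (pr ≫ pr₁) ≫ p₀ = pT ≫ (v ≫ j))

/-- Transports of a section along any two chains of identifications of opens agree. [folklore] -/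
private theorem presheaf_map_eq_of_eq {X : Scheme.{u}} (N : X.Modules) {U₁ U₂ : X.Opens}
    (a b : U₂ ⟶ U₁) (x : Γ(N, U₁)) : N.presheaf.map a.op x = N.presheaf.map b.op x := by
  rw [Subsingleton.elim a b]

/-- **PASTING LAW for the base-change morphism** ([StacksProject, Tag 02N6]: base change maps are
compatible with horizontal composition of squares): for commutative squares
```
XT —pr→ X₁ —pr₁→ X₀
 |pT      |p₁        |p₀
 T ——v——→ S₁ ——j——→ S₀
```
the base-change morphism of the outer square along `v ≫ j` is, up to the pseudofunctoriality
isomorphisms `(v ≫ j)^* ≅ v^* j^*` and `pr^* pr₁^* ≅ (pr ≫ pr₁)^*` (Mathlib `Scheme.Modules.pullbackComp`), the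
composite `v^*(β_{w₁}) ≫ β_w`.  Proof: both sides send a pulled-back section `η_{v ≫ j}(s)`, `s ∈ Γ(G, p₀⁻¹V)`, to
`η_{pr ≫ pr₁}(s)` (★ `pushforwardBaseChangeHom_app_unitSection`), and morphisms out of an inverse image are
determined by these values (§1). [cite: StacksProject, Tag 02N6] [cite: Hartshorne1977, III Prop. 9.3 (Remark 9.3.1)] -/
theorem pushforwardBaseChangeHom_paste (G : X₀.Modules) :
    pushforwardBaseChangeHom w' G =
      (Scheme.Modules.pullbackComp v j).inv.app ((Scheme.Modules.pushforward p₀).obj G) ≫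
        (Scheme.Modules.pullback v).map (pushforwardBaseChangeHom w₁ G) ≫
          pushforwardBaseChangeHom w ((Scheme.Modules.pullback pr₁).obj G) ≫
            (Scheme.Modules.pushforward pT).map ((Scheme.Modules.pullbackComp pr pr₁).hom.app G) := by
  apply pullback_hom_ext_unitSection (v ≫ j)
  intro V s
  -- LHS: `η_{v ≫ j}(s) ↦ η_{pr ≫ pr₁}(s)`
  rw [pushforwardBaseChangeHom_app_unitSection w' G V s]
  -- RHS, step by step
  simp only [Scheme.Modules.Hom.comp_app, CategoryTheory.comp_apply]
  erw [pullbackComp_inv_app_unitSection j ((Scheme.Modules.pushforward p₀).obj G) v V s]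
  erw [pullback_map_app_unitSection v (pushforwardBaseChangeHom w₁ G) (j ⁻¹ᵁ V)]
  rw [pushforwardBaseChangeHom_app_unitSection w₁ G V s]
  erw [pushforwardBaseChangeHom_app_unitSection w ((Scheme.Modules.pullback pr₁).obj G) (j ⁻¹ᵁ V)]
  dsimp only
  erw [unitSection_map pr ((Scheme.Modules.pullback pr₁).obj G)
    (eqToHom (preimage_preimage_eq_of_sq w₁ V).symm) (unitSection pr₁ G (p₀ ⁻¹ᵁ V) s)]
  erw [Scheme.Modules.pushforward_map_app]
  erw [app_presheaf_map, app_presheaf_map]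
  erw [pullbackComp_hom_app_unitSection pr₁ G pr (p₀ ⁻¹ᵁ V) s]
  rw [← CategoryTheory.comp_apply, ← Functor.map_comp]
  exact presheaf_map_eq_of_eq _ _ _ _

/-- **The (VI)-clause is insensitive to pasting** ([MumfordFogartyKirwan1994] Prop. 7.3 step (VI), read on two squares):
for any `u : E ⟶ (p₀)_* G`, the composite `v^*(j^* u ≫ β_{w₁}) ≫ β_w : v^* j^* E ⟶ (pT)_*(pr^* pr₁^* G)` is an
isomorphism iff `(v ≫ j)^* u ≫ β_{w'} : (v ≫ j)^* E ⟶ (pT)_*((pr ≫ pr₁)^* G)` is — the two differ by the invertible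
pseudofunctoriality isomorphisms (`pushforwardBaseChangeHom_paste`).
[cite: StacksProject, Tag 02N6] [cite: MumfordFogartyKirwan1994, Ch. 7 §2 Prop. 7.3, step (VI) of the proof (p. 134)] -/
theorem isIso_pullback_map_comp_pushforwardBaseChangeHom_iff_of_paste (G : X₀.Modules) {E : S₀.Modules}
    (u : E ⟶ (Scheme.Modules.pushforward p₀).obj G) :
    IsIso ((Scheme.Modules.pullback v).map ((Scheme.Modules.pullback j).map u ≫ pushforwardBaseChangeHom w₁ G) ≫
        pushforwardBaseChangeHom w ((Scheme.Modules.pullback pr₁).obj G)) ↔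
      IsIso ((Scheme.Modules.pullback (v ≫ j)).map u ≫ pushforwardBaseChangeHom w' G) := by
  have key : (Scheme.Modules.pullback (v ≫ j)).map u ≫ pushforwardBaseChangeHom w' G =
      (Scheme.Modules.pullbackComp v j).inv.app E ≫
        ((Scheme.Modules.pullback v).map ((Scheme.Modules.pullback j).map u ≫ pushforwardBaseChangeHom w₁ G) ≫
          pushforwardBaseChangeHom w ((Scheme.Modules.pullback pr₁).obj G)) ≫
        (Scheme.Modules.pushforward pT).map ((Scheme.Modules.pullbackComp pr pr₁).hom.app G) := by
    rw [pushforwardBaseChangeHom_paste w₁ w w' G, Functor.map_comp]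
    have hn := (Scheme.Modules.pullbackComp v j).inv.naturality u
    simp only [Functor.comp_map] at hn
    simp only [Category.assoc]
    rw [← Category.assoc ((Scheme.Modules.pullback (v ≫ j)).map u), hn, Category.assoc]
  rw [key]
  constructor
  · intro h
    infer_instance
  · intro h
    have h' := IsIso.of_isIso_comp_left ((Scheme.Modules.pullbackComp v j).inv.app E)
      (((Scheme.Modules.pullback v).map ((Scheme.Modules.pullback j).map u ≫ pushforwardBaseChangeHom w₁ G) ≫
          pushforwardBaseChangeHom w ((Scheme.Modules.pullback pr₁).obj G)) ≫
        (Scheme.Modules.pushforward pT).map ((Scheme.Modules.pullbackComp pr pr₁).hom.app G))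
    exact IsIso.of_isIso_comp_right _
      ((Scheme.Modules.pushforward pT).map ((Scheme.Modules.pullbackComp pr pr₁).hom.app G))

/-- **The (VI)-clause is insensitive to pasting, cartesian letters**: for cartesian squares `H₁ : X₁ = X₀ ×_{S₀} S₁` over
`j` and `H : XT = X₁ ×_{S₁} T` over `v`, and the pasted square `H.paste_horiz H₁ : XT = X₀ ×_{S₀} T` over `v ≫ j`
(Mathlib `IsPullback.paste_horiz`), the clause «`u` pulled back frames the direct image» read along `v` on the data
already pulled back to `S₁` agrees with the clause read along `v ≫ j` on the original data.
[cite: StacksProject, Tag 02N6] [cite: MumfordFogartyKirwan1994, Ch. 7 §2 Prop. 7.3, step (VI) of the proof (p. 134)] -/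
theorem isIso_pullback_map_comp_pushforwardBaseChangeHom_iff_of_isPullback_paste_horiz
    (H₁ : IsPullback pr₁ p₁ p₀ j) (H : IsPullback pr pT p₁ v) (G : X₀.Modules) {E : S₀.Modules}
    (u : E ⟶ (Scheme.Modules.pushforward p₀).obj G) :
    IsIso ((Scheme.Modules.pullback v).map ((Scheme.Modules.pullback j).map u ≫ pushforwardBaseChangeHom H₁.w G) ≫
        pushforwardBaseChangeHom H.w ((Scheme.Modules.pullback pr₁).obj G)) ↔
      IsIso ((Scheme.Modules.pullback (v ≫ j)).map u ≫ pushforwardBaseChangeHom (H.paste_horiz H₁).w G) :=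
  isIso_pullback_map_comp_pushforwardBaseChangeHom_iff_of_paste H₁.w H.w (H.paste_horiz H₁).w G u

end Paste

/-! ### §3 Two presentations of the same square; transport of a module clause along `pr^* pr₁^* ≅ (pr ≫ pr₁)^*` -/

section Congr

variable {X S T XT : Scheme.{u}} {p : X ⟶ S} {pT : XT ⟶ T} {b : T ⟶ S} {pr pr' : XT ⟶ X}
  (w : pr ≫ p = pT ≫ b) (w' : pr' ≫ p = pT ≫ b)

/-- **Equal top arrows give the same base-change morphism** up to `pullbackCongr`: two presentations `pr`, `pr'` of the
top arrow of one square (e.g. `K` and `(K.of_right …).paste_horiz H₁`, whose top arrows `prK` and `lift ≫ pr₁` are equal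
but not syntactically) have base-change morphisms differing by the identification `pr^* G ≅ pr'^* G`.
[cite: StacksProject, Tag 02N6] -/
theorem pushforwardBaseChangeHom_congr_fst (h : pr = pr') (G : X.Modules) :
    pushforwardBaseChangeHom w' G =
      pushforwardBaseChangeHom w G ≫
        (Scheme.Modules.pushforward pT).map ((Scheme.Modules.pullbackCongr h).hom.app G) := by
  subst h
  simp only [Scheme.Modules.pullbackCongr, eqToIso_refl, Iso.refl_hom, NatTrans.id_app]
  erw [CategoryTheory.Functor.map_id, Category.comp_id]

/-- The (VI)-clause «`b^* u ≫ β` is an isomorphism» does not depend on the presentation of the top arrow of the square.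
[cite: StacksProject, Tag 02N6] [cite: MumfordFogartyKirwan1994, Ch. 7 §2 Prop. 7.3, step (VI) of the proof (p. 134)] -/
theorem isIso_pullback_map_comp_pushforwardBaseChangeHom_iff_of_eq_fst (h : pr = pr') (G : X.Modules)
    {E : S.Modules} (u : E ⟶ (Scheme.Modules.pushforward p).obj G) :
    IsIso ((Scheme.Modules.pullback b).map u ≫ pushforwardBaseChangeHom w G) ↔
      IsIso ((Scheme.Modules.pullback b).map u ≫ pushforwardBaseChangeHom w' G) := by
  subst h
  exact Iff.rfl

end Congr

section Transport

/-- `Nonempty (A ≅ N)` is invariant under replacing `A` by an isomorphic object. [folklore] -/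
private theorem nonempty_iso_iff_of_iso {C : Type*} [Category C] {A A' N : C} (e : A ≅ A') :
    Nonempty (A ≅ N) ↔ Nonempty (A' ≅ N) :=
  ⟨fun ⟨i⟩ => ⟨e.symm ≪≫ i⟩, fun ⟨i⟩ => ⟨e ≪≫ i⟩⟩

variable {X₀ X₁ XT : Scheme.{u}} (pr : XT ⟶ X₁) (pr₁ : X₁ ⟶ X₀)

/-- **A module clause moves along `pr^* pr₁^* ≅ (pr ≫ pr₁)^*`**: for an `𝒪_{X₀}`-module `L` and any `𝒪_{XT}`-module
`N` (e.g. `N = M^{⊗3}` in the `L^Δ(λ)³`-clause of [MumfordFogartyKirwan1994] Prop. 7.3 step (V)),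
`Nonempty (pr^*(pr₁^* L) ≅ N) ↔ Nonempty ((pr ≫ pr₁)^* L ≅ N)` (Mathlib `Scheme.Modules.pullbackComp`).
[cite: StacksProject, Tag 0097] [cite: MumfordFogartyKirwan1994, Ch. 7 §2 Prop. 7.3, step (V) of the proof (p. 134)] -/
theorem nonempty_pullback_pullback_iso_iff (L : X₀.Modules) (N : XT.Modules) :
    Nonempty ((Scheme.Modules.pullback pr).obj ((Scheme.Modules.pullback pr₁).obj L) ≅ N) ↔
      Nonempty ((Scheme.Modules.pullback (pr ≫ pr₁)).obj L ≅ N) :=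
  nonempty_iso_iff_of_iso ((Scheme.Modules.pullbackComp pr pr₁).app L)

end Transport

end Literature.AlgebraicGeometry.Modules

end
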